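import Literature.AnabelianGeometry.EtaleTheta.FrobenioidRootTransport
import Mathlib.CategoryTheory.SingleObj
import Mathlib.Topology.Instances.ZMod
import Mathlib.Algebra.Field.ZMod
import Mathlib.Tactic.LinearCombination

/-!
# [EtTh] Theorem 5.7 / Theorem 4.4 (iv) at the `N`-th root: the universal closures over the abstract §5
# interface are FALSE (kernel countermodel; FACT-LIST rows F-0548, F-0549, F-0550, F-2768 — R5 «named instances only»)

Mochizuki, *The étale theta function and its Frobenioid-theoretic manifestations*, Publ. RIMS **45**
(2009), Theorem 5.7 (pp.329–330 (PDF pp.103–104)), Theorem 4.4 (iv) (p.320 (PDF p.94)), proof of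
Theorem 5.10 (ii) (pp.334–335 (PDF pp.108–109)) [cite: MochizukiEtTh2009, Thm 5.7 p.329–330 (PDF pp.103–104)].
Cell abc-iut, block F (fact-proving wave), seat abc-iut-w5-d066 (tranche 124 of `plan/F-TRANCHES.tsv`);
PROOF-ONLY companion of abc-iut-L2-t4's `FrobenioidRootTransport.lean` (statements `ThetaFrobenioid.RootTransport`,
`RootTransportWith`, `ThetaRootPreserved`, `StrvTransport`).  No new `Prop` fact, no edit of the statement file;
the only definitions are the toy datum below.

WHAT IS PROVED.  The four statements are PREDICATES on the §5 data `𝔉 : ThetaFrobenioid C D` (DATA ONLY: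
`PreFrobenioidData` + §5 extras; nothing says `C` is the tempered Frobenioid of [EtTh] Example 3.9) and on a
self-equivalence `Ψ : C ≌ C` with identifications `α : Ψ(A_N) ⥲ A_N`, `β : Ψ(B_N) ⥲ B_N` (resp. witnesses
`e, D_c, D_p`, resp. `e, θ`).  Their universal closures («for EVERY such datum and EVERY `Ψ, α, β, …`») are
refuted in the kernel by ONE toy datum `toyTheta` (all universes `0`):
* `C = D := SingleObj (ℤ/3)` (one object `⋆`, arrows `ℤ/3`, written multiplicatively); base functor the one
  induced by the TRIVIAL homomorphism `ℤ/3 → ℤ/3` (so every arrow is base-identity and every parallel pair is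
  base-equivalent); divisor monoids trivial; all Frobenius degrees `1`;
* `A_⊚ = A_N = B_N := ⋆`, `s^⊓_N := g` (the generator `1 ∈ ℤ/3`), `s^⊔_N := 𝟙 = 0 ∈ ℤ/3`, `N := 1`, `l := 1`,
  `O^×(⋆) = Aut(⋆) = ℤ/3 = O^×(⋆^birat)`, `K := 𝔽₂` (so `K^× = 1`, `(K^×)^{1/N} = 1`), `s^trv_N := id`,
  `s^⊓-gp_N = s^⊔-gp_N := 1`, `Π^tp_X := ℤ × ℤ/2 ↠ Aut_D(⋆) = ℤ/3` through `ℤ ↠ ℤ/3`;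
* `Ψ := Ψσ`, the self-equivalence of `SingleObj (ℤ/3)` induced by the group automorphism `σ = (·)⁻¹` of `ℤ/3`.
Then, for EVERY `α, β ∈ Aut(⋆)`: the two transport equations of `RootTransport Ψσ α β` force (commutativity)
`D_c · D_p⁻¹ = σ(g)⁻¹ · g = g²` while the third conjunct forces `D_c⁻¹ · D_p ∈ (μ₂(⋆) ∩ 1) · 1 = 1` — absurd
in `ℤ/3` (`not_rootTransport_toy`); hence `ThetaRootPreserved Ψσ` fails, `RootTransportWith` fails at any
witnesses, and `StrvTransport Ψσ id id id` fails at `g` (`σ(g) ≠ g`).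

WHAT THIS MEANS FOR THE ROWS (R5).  Theorem 5.7 is a theorem about the tempered Frobenioid of [EtTh] §5 (its
printed proof, p.330 (PDF p.104), runs through "compatible systems as in Remark 4.3.2", "the rigidity of the
étale theta function [Corollary 2.8, (i)]", Proposition 5.5 and Theorem 5.6 — statements about the MODEL that
the data-only interface cannot express), so the rows are admissible AT NAMED INSTANCES / in CONDITIONAL form
only: the theorems of record are abc-iut-L2-d4's `Discharge/Sec5Thm57.rootTransport_of` /
`thetaRootPreserved_of` / `rootTransportWith_of_unit` (modulo the printed inputs `hepi hiso hiiid hpre hbe hdiv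
hrig`), `Discharge/Sec5ModelCaseTorsion.rootTransport_of_model_slim_torsion` (model case) and
`Discharge/Sec5StrvTransportOfBiKummerData.exists_unit_strvTransport_ofBiKummerData` (Thm 4.4 (iv) at the
bi-Kummer data).  A consumer binding `(h : ∀ 𝔉 Ψ α β, RootTransport 𝔉 Ψ α β)` would be binding `False`.
HONEST FRAMING: a toy datum says nothing about the tempered Frobenioid of [EtTh] §5, nothing about the truth
of Theorem 5.7 for it, and nothing about [IUTchIII] Cor. 3.12; no side is taken; typed ≠ proved.
-/

namespace Literature.AnabelianGeometry.EtaleTheta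

namespace ThetaFrobenioid

namespace Thm57Toy

open CategoryTheory
open Literature.AlgebraicGeometry.Frobenioids

/-- The group `ℤ/3`, written multiplicatively (plays `Aut_C(⋆) = O^×(⋆) = O^×(⋆^birat) = Aut_D(⋆^bs)`).
[cite: MochizukiEtTh2009, Thm 5.7 p.329 (PDF p.103)] -/
abbrev G3 : Type := Multiplicative (ZMod 3)

/-- The generator `g = 1 ∈ ℤ/3` (plays `s^⊓_N`). [cite: MochizukiEtTh2009, Thm 5.7 p.329 (PDF p.103)] -/
abbrev g1 : G3 := Multiplicative.ofAdd 1

/-- The toy category `C = D := SingleObj (ℤ/3)`. [cite: MochizukiEtTh2009, Thm 5.7 p.329 (PDF p.103)] -/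
abbrev TC : Type := SingleObj G3

/-- The unique object `⋆` (plays `A_⊚ = A_N = B_N`). [cite: MochizukiEtTh2009, Thm 5.7 p.329 (PDF p.103)] -/
abbrev O : TC := SingleObj.star G3

/-- Read an arrow of `SingleObj (ℤ/3)` as an element of `ℤ/3` (additively).
[cite: MochizukiEtTh2009, Thm 5.7 p.329 (PDF p.103)] -/
abbrev rd {X Y : TC} (f : X ⟶ Y) : ZMod 3 := Multiplicative.toAdd (show G3 from f)

/-- The toy pre-Frobenioid data: base functor induced by the trivial homomorphism `ℤ/3 → ℤ/3`, trivial
divisors, all Frobenius degrees `1`. [cite: MochizukiEtTh2009, Thm 5.7 p.329 (PDF p.103)] -/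
def toyPre : PreFrobenioidData.{0} TC TC where
  base := (1 : G3 →* G3).toFunctor
  Mon := fun _ => Unit
  pull := fun _ => MonoidHom.id Unit
  pull_id := fun _ _ => rfl
  pull_comp := fun _ _ _ => rfl
  div := fun _ => ()
  degFr := fun _ => 1
  div_id := fun _ => rfl
  div_comp := fun _ _ => rfl
  degFr_id := fun _ => rfl
  degFr_comp := fun _ _ => (mul_one _).symm

/-- Automorphism groups of the toy category are commutative (`ℤ/3`).
[cite: MochizukiEtTh2009, Thm 5.7 p.329 (PDF p.103)] -/
theorem aut_mul_comm (S : TC) (a b : Aut S) : a * b = b * a := by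
  apply Aut.ext
  change (b.hom ≫ a.hom) = (a.hom ≫ b.hom)
  exact @mul_comm G3 _ a.hom b.hom

/-- `Aut_C(S) → ℤ/3`, `a ↦ a.hom` (plays `O^×(S) ↪ O^×(S^birat)`). [cite: MochizukiEtTh2009, Lem 5.8 p.331 (PDF p.105)] -/
def autToG (S : TC) : Aut S →* G3 where
  toFun a := a.hom
  map_one' := rfl
  map_mul' _ _ := rfl

/-- `a ↦ a.hom` is injective. [cite: MochizukiEtTh2009, Lem 5.8 p.331 (PDF p.105)] -/
theorem autToG_injective (S : TC) : Function.Injective (autToG S) := fun _ _ h => Aut.ext h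

/-- `ℤ/3 → Aut_C(⋆)`, `x ↦ (x, x⁻¹)` (every arrow of a one-object groupoid is an automorphism).
[cite: MochizukiEtTh2009, Def 4.1 (ii) p.313 (PDF p.87)] -/
def autOfG : G3 →* Aut O where
  toFun x := ⟨x, (x⁻¹ : G3), inv_mul_cancel x, mul_inv_cancel x⟩
  map_one' := Aut.ext rfl
  map_mul' _ _ := Aut.ext rfl

/-- `(autOfG x).hom = x`. [cite: MochizukiEtTh2009, Def 4.1 (ii) p.313 (PDF p.87)] -/
theorem autOfG_hom (x : G3) : (autOfG x).hom = x := rfl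

/-- The automorphism `g` of `⋆` (hom component the generator of `ℤ/3`).
[cite: MochizukiEtTh2009, Thm 4.4 (iv) p.320 (PDF p.94)] -/
abbrev gAut : Aut O := autOfG g1

/-- The toy `TemperedFrobenioidStub`: `O^×(S^birat) := ℤ/3`, units read through their hom component, trivial unit
pull-backs, every arrow "of base-Frobenius type". [cite: MochizukiEtTh2009, §5 p.322 (PDF p.96)] -/
def toyStub : FrobenioidTheta.TemperedFrobenioidStub.{0} TC TC where
  pre := toyPre
  units_comm S := ⟨⟨fun a b => Subtype.ext (aut_mul_comm S a.1 b.1)⟩⟩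
  biratUnits := fun _ => G3
  unitsToBirat S := (autToG S).comp (toyPre.unitsSubgroup S).subtype
  unitsToBirat_injective S := fun _ _ h => Subtype.ext (autToG_injective S h)
  unitsPull := fun _ => 1
  IsBaseFrobeniusType := ⊤

/-- `Ker(pr₁ : ℤ × ℤ/2 → ℤ) ≃ ℤ/2` (for the index-`2` clause of the §5 data).
[cite: MochizukiEtTh2009, Thm 5.10 (iii) proof p.335 (PDF p.109)] -/
def kerFstEquiv : (MonoidHom.fst (Multiplicative ℤ) (Multiplicative (ZMod 2))).ker ≃ ZMod 2 where
  toFun x := Multiplicative.toAdd x.1.2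
  invFun t := ⟨(1, Multiplicative.ofAdd t), (MonoidHom.mem_ker).mpr rfl⟩
  left_inv x := by
    obtain ⟨⟨a, t⟩, h⟩ := x
    have h' : a = 1 := (MonoidHom.mem_ker).mp h
    subst h'
    rfl
  right_inv _ := rfl

/-- `ℤ × ℤ/2 ↠ ℤ/3` (first projection, then reduction mod `3`), valued in `Aut_D(⋆^bs)` (plays `ρ : Π^tp_X ↠ Aut_D(B_N^bs)`).
[cite: MochizukiEtTh2009, Def 4.1 (ii) p.313 (PDF p.87)] -/
def toyRho : Multiplicative ℤ × Multiplicative (ZMod 2) →* Aut O :=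
  autOfG.comp ((Int.castAddHom (ZMod 3)).toMultiplicative.comp (MonoidHom.fst _ _))

/-- `toyRho` is surjective. [cite: MochizukiEtTh2009, Def 4.1 (ii) p.313 (PDF p.87)] -/
theorem toyRho_surjective : Function.Surjective toyRho := by
  intro t
  obtain ⟨z, hz⟩ := ZMod.intCast_surjective (Multiplicative.toAdd (autToG O t))
  refine ⟨(Multiplicative.ofAdd z, 1), Aut.ext ?_⟩
  calc (toyRho (Multiplicative.ofAdd z, 1)).hom = Multiplicative.ofAdd ((z : ZMod 3)) := rfl
    _ = Multiplicative.ofAdd (Multiplicative.toAdd (autToG O t)) := by rw [hz]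
    _ = t.hom := rfl

/-- **The toy §5 datum** `𝔉_toy : ThetaFrobenioid C D` over `C = D = SingleObj (ℤ/3)` (every field of the DATA-ONLY
interface supplied; `A_⊚ = A_N = B_N = ⋆`, `s^⊓_N = g`, `s^⊔_N = 𝟙`, `N = 1`, `l = 1`, `Π^tp_X = ℤ × ℤ/2` (discrete),
`Π^tp_Ÿ = 1`, `K = 𝔽₂`, `s^trv_N = id`, `s^⊓-gp_N = s^⊔-gp_N = 1`).  [cite: MochizukiEtTh2009, §5 p.322–333 (PDF pp.96–107)] -/
def toyTheta : ThetaFrobenioid.{0} TC TC where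
  toTemperedFrobenioidStub := toyStub
  lDelta := fun _ => Unit
  lDeltaMap := fun _ => MonoidHom.id Unit
  l := 1
  odd_l := odd_one
  N := 1
  Acirc := O
  AN := O
  BN := O
  sCap := g1
  sCup := 𝟙 O
  base_map_sCap := rfl
  isPreStep_sCap := ⟨rfl, by change IsIso (X := O) (Y := O) (1 : G3); infer_instance⟩
  isPreStep_sCup := ⟨rfl, by change IsIso (X := O) (Y := O) (1 : G3); infer_instance⟩
  PiX := Multiplicative ℤ × Multiplicative (ZMod 2)
  zquot := MonoidHom.fst _ _
  zquot_surjective := fun z => ⟨(z, 1), rfl⟩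
  PiYdd := ⊥
  PiYdd_le := bot_le
  relindex_PiYdd := by
    rw [Subgroup.relIndex_bot_left, Nat.card_congr kerFstEquiv, Nat.card_zmod]
  PiYdd_normal := inferInstance
  isOpen_PiYdd := isOpen_discrete _
  ρ := toyRho
  ρ_surjective := toyRho_surjective
  isOpen_ker_ρ := isOpen_discrete _
  strv := MonoidHom.id (Aut O)
  sgpCap := 1
  sgpCup := 1
  K := ZMod 2
  constEmb := 1
  constEmb_injective := by
    intro a b _
    have h : ∀ u : (ZMod 2)ˣ, u = 1 := by decide
    rw [h a, h b]
  thetaFn := (1 : G3)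

/-- **The self-equivalence `Ψσ` of `SingleObj (ℤ/3)`** induced by the group automorphism `σ = (·)⁻¹` of `ℤ/3`
(plays the self-equivalence `Ψ` of Theorem 5.7 / 5.10).  [cite: MochizukiEtTh2009, Thm 5.7 p.329 (PDF p.103)] -/
def Ψσ : TC ≌ TC := (MulEquiv.inv G3).toSingleObjEquiv

/-- `Ψσ` acts on arrows by inversion. [cite: MochizukiEtTh2009, Thm 5.7 p.329 (PDF p.103)] -/
theorem Ψσ_map (x : O ⟶ O) : Ψσ.functor.map x = (x⁻¹ : G3) := rfl

/-- `A_N = ⋆`, `B_N = ⋆`, `s^⊓_N = g`, `s^⊔_N = 𝟙`, `N = 1`, `l = 1` in the toy datum (all `rfl`).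
[cite: MochizukiEtTh2009, Thm 5.7 p.329 (PDF p.103)] -/
theorem toyTheta_sCap : toyTheta.sCap = g1 := rfl

/-- The exponent `2·l·N` of Theorem 5.7's "`2l`-th root of unity" clause is `2` in the toy datum.
[cite: MochizukiEtTh2009, Thm 5.7 p.330 (PDF p.104)] -/
theorem toyTheta_two_l_N : 2 * toyTheta.l * (toyTheta.N : ℕ) = 2 := rfl

/-! ### Theorem 5.7 at the root fails at the toy datum, for EVERY `α, β` -/

/-- **Theorem 5.7 at the `N`-th root FAILS at `(𝔉_toy, Ψσ)` for every choice of `α, β`**: the two transport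
equations force `D_c · D_p⁻¹ = g²` (all automorphism groups are the commutative `ℤ/3` and `Ψσ(g) = g⁻¹`), while
the third conjunct forces `D_c⁻¹ · D_p ∈ (μ₂(⋆) ∩ (O_K^×)^{1/N}) · Im(s^⊓-gp_N) = 1`.
[cite: MochizukiEtTh2009, Thm 5.7 p.329–330 (PDF pp.103–104)] -/
theorem not_rootTransport_toy (α : Ψσ.functor.obj toyTheta.AN ≅ toyTheta.AN)
    (β : Ψσ.functor.obj toyTheta.BN ≅ toyTheta.BN) : ¬ toyTheta.RootTransport Ψσ α β := by
  rintro ⟨e, Dc, Dp, h1, h2, δ₂, hδ₂, δ₃, hδ₃, h3⟩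
  -- the translate `δ₃ ∈ Im(s^⊓-gp_N) = 1` is trivial
  obtain ⟨y, hy⟩ := MonoidHom.mem_range.mp hδ₃
  have hδ₃1 : δ₃ = 1 := by rw [← hy]; rfl
  subst hδ₃1
  -- the constant `δ₂ ∈ μ_{2lN}(⋆)` is `2`-torsion
  have hμ : δ₂ * δ₂ = 1 := by
    have h := (toyTheta.mem_muTorsion.mp (Subgroup.mem_inf.mp hδ₂).1).2
    rwa [toyTheta_two_l_N, pow_two] at h
  -- read the five relations in `ℤ/3` (additively); all by `rfl` unfolding (`f ≫ g = g * f`, `toAdd (a * b) = …`)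
  change α.inv ≫ (MulEquiv.inv G3) g1 ≫ β.hom = e.hom ≫ g1 ≫ Dc.hom at h1
  change α.inv ≫ (MulEquiv.inv G3) (1 : G3) ≫ β.hom = e.hom ≫ (1 : G3) ≫ Dp.hom at h2
  have h1' : rd β.hom + -(1 : ZMod 3) + rd α.inv
      = rd Dc.hom + 1 + rd e.hom := congrArg rd h1
  have h2' : rd β.hom + -(0 : ZMod 3) + rd α.inv
      = rd Dp.hom + 0 + rd e.hom := congrArg rd h2
  have h3' : rd Dc.inv + rd Dp.hom
      = rd δ₂.hom + (0 : ZMod 3) :=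
    congrArg (fun u : Aut toyTheta.BN => rd u.hom) h3
  have hinv : rd Dc.inv + rd Dc.hom = (0 : ZMod 3) :=
    congrArg rd Dc.hom_inv_id
  have hμ' : rd δ₂.hom + rd δ₂.hom = (0 : ZMod 3) :=
    congrArg (fun u : Aut toyTheta.BN => rd u.hom) hμ
  have key : (4 : ZMod 3) = 0 := by
    linear_combination (-2 : ZMod 3) * h1' + 2 * h2' + 2 * h3' - 2 * hinv + hμ'
  exact absurd key (by decide)

/-- **F-0550: Theorem 5.7, all-choices form, FAILS at `(𝔉_toy, Ψσ)`** (there `α = β = id` are available choices).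
[cite: MochizukiEtTh2009, Thm 5.7 p.329–330 (PDF pp.103–104)] -/
theorem not_thetaRootPreserved_toy : ¬ toyTheta.ThetaRootPreserved Ψσ :=
  fun h => not_rootTransport_toy (Iso.refl _) (Iso.refl _) (h (Iso.refl _) (Iso.refl _))

/-- **F-0549: the witnesses-exposed form FAILS at `(𝔉_toy, Ψσ)`** for every `α, β, e, D_c, D_p` (it implies
`RootTransport`).  [cite: MochizukiEtTh2009, Thm 5.7 p.329–330 (PDF pp.103–104)] -/
theorem not_rootTransportWith_toy (α : Ψσ.functor.obj toyTheta.AN ≅ toyTheta.AN)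
    (β : Ψσ.functor.obj toyTheta.BN ≅ toyTheta.BN) (e : toyTheta.AN ≅ toyTheta.AN) (Dc Dp : Aut toyTheta.BN) :
    ¬ toyTheta.RootTransportWith Ψσ α β e Dc Dp :=
  fun h => not_rootTransport_toy α β h.rootTransport

/-! ### Theorem 4.4 (iv) at the root (`StrvTransport`) fails at the toy datum -/

/-- **F-2768: the `s^trv_N`-transport FAILS at `(𝔉_toy, Ψσ, α = e = id, θ = id)`**: at the base automorphism
`g` it reads `σ(g) = g`, i.e. `g⁻¹ = g` in `ℤ/3`.  [cite: MochizukiEtTh2009, Thm 4.4 (iv) p.320 (PDF p.94)] -/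
theorem not_strvTransport_toy :
    ¬ toyTheta.StrvTransport Ψσ (Iso.refl _) (Iso.refl _) (MulEquiv.refl _) := by
  intro h
  have h1 := h (toyTheta.autBaseIsoAB gAut)
  simp only [MulEquiv.refl_apply, MulEquiv.symm_apply_apply, Iso.refl_hom, Iso.refl_inv,
    Category.id_comp, Category.comp_id] at h1
  change (g1 : G3)⁻¹ = g1 at h1
  exact absurd (congrArg Multiplicative.toAdd h1) (by decide)

end Thm57Toy

/-! ### The universal closures of the four rows are FALSE -/

open CategoryTheory Thm57Toy in
/-- **F-0548: the universal closure of `ThetaFrobenioid.RootTransport` is FALSE** (R5: the row is an assumption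
about NAMED §5 data — conditional forms `Discharge/Sec5Thm57.rootTransport_of`,
`Sec5ModelCaseTorsion.rootTransport_of_model_slim_torsion` — never a theorem of the interface).
[cite: MochizukiEtTh2009, Thm 5.7 p.329–330 (PDF pp.103–104)] -/
theorem not_forall_rootTransport :
    ¬ ∀ (C : Type) [Category.{0} C] (D : Type) [Category.{0} D] (𝔉 : ThetaFrobenioid.{0} C D)
        (Ψ : C ≌ C) (α : Ψ.functor.obj 𝔉.AN ≅ 𝔉.AN) (β : Ψ.functor.obj 𝔉.BN ≅ 𝔉.BN),
        𝔉.RootTransport Ψ α β :=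
  fun h => not_rootTransport_toy (Iso.refl _) (Iso.refl _) (h TC TC toyTheta Ψσ (Iso.refl _) (Iso.refl _))

open CategoryTheory Thm57Toy in
/-- **F-0549: the universal closure of `ThetaFrobenioid.RootTransportWith` is FALSE** (R5: named §5 data /
conditional form `Discharge/Sec5Thm57.rootTransportWith_of_unit` only).
[cite: MochizukiEtTh2009, Thm 5.7 p.329–330 (PDF pp.103–104)] -/
theorem not_forall_rootTransportWith :
    ¬ ∀ (C : Type) [Category.{0} C] (D : Type) [Category.{0} D] (𝔉 : ThetaFrobenioid.{0} C D)
        (Ψ : C ≌ C) (α : Ψ.functor.obj 𝔉.AN ≅ 𝔉.AN) (β : Ψ.functor.obj 𝔉.BN ≅ 𝔉.BN)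
        (e : 𝔉.AN ≅ 𝔉.AN) (Dc Dp : Aut 𝔉.BN), 𝔉.RootTransportWith Ψ α β e Dc Dp :=
  fun h => not_rootTransportWith_toy (Iso.refl _) (Iso.refl _) (Iso.refl _) 1 1
    (h TC TC toyTheta Ψσ (Iso.refl _) (Iso.refl _) (Iso.refl _) 1 1)

open CategoryTheory Thm57Toy in
/-- **F-0550: the universal closure of `ThetaFrobenioid.ThetaRootPreserved` is FALSE** (R5: named §5 data /
conditional form `Discharge/Sec5Thm57.thetaRootPreserved_of` only).
[cite: MochizukiEtTh2009, Thm 5.7 p.329–330 (PDF pp.103–104)] -/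
theorem not_forall_thetaRootPreserved :
    ¬ ∀ (C : Type) [Category.{0} C] (D : Type) [Category.{0} D] (𝔉 : ThetaFrobenioid.{0} C D)
        (Ψ : C ≌ C), 𝔉.ThetaRootPreserved Ψ :=
  fun h => not_thetaRootPreserved_toy (h TC TC toyTheta Ψσ)

open CategoryTheory Thm57Toy in
/-- **F-2768: the universal closure of `ThetaFrobenioid.StrvTransport` is FALSE** (R5: named §5 data — witness
theorem `Discharge/Sec5StrvTransportOfBiKummerData.exists_unit_strvTransport_ofBiKummerData` at the bi-Kummer data —
never a theorem of the interface).  [cite: MochizukiEtTh2009, Thm 4.4 (iv) p.320 (PDF p.94)] -/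
theorem not_forall_strvTransport :
    ¬ ∀ (C : Type) [Category.{0} C] (D : Type) [Category.{0} D] (𝔉 : ThetaFrobenioid.{0} C D)
        (Ψ : C ≌ C) (α : Ψ.functor.obj 𝔉.AN ≅ 𝔉.AN) (e : 𝔉.AN ≅ 𝔉.AN)
        (θ : Aut (𝔉.base.obj 𝔉.BN) ≃* Aut (𝔉.base.obj 𝔉.BN)), 𝔉.StrvTransport Ψ α e θ :=
  fun h => not_strvTransport_toy (h TC TC toyTheta Ψσ (Iso.refl _) (Iso.refl _) (MulEquiv.refl _))

end ThetaFrobenioid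

end Literature.AnabelianGeometry.EtaleTheta
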